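import Summits.CriticalPhenomena.CardyFormulaZ2.Theses.CardyGluingRDE
import Literature.Probability.Percolation.QuadCrossingDiscreteGluingGarban

/-!
# Route `CardyGluingRDE` — support item `FourArmOfGarban` (stmt-CriticalPhenomena-9115)

`FourArmOfGarban : Garban2011_fourArm_multiscale → FourArmBeyondOne`.  Garban's multi-scale
four-arm bound for critical bond percolation on `ℤ²` (Schramm–Smirnov 2011, Appendix B;
van den Berg–Nolin 2020, Lemma 8) is conditional on a polychromatic two-arm bound
`π₂(m,n) ≤ c' (m/n)^{2ε}`; that input is an RSW consequence at `p = 1/2`, namely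
`π₂ ≤ π₁ ≤ C (m/n)^α` (tree: `twoArmOpenDual_subset_openCrossing` and
`real_sqAnnulusOpenCrossing_le_rpow_of_le_half`).  The complete discharge is already in the tree
as `Literature.Probability.Percolation.QuadCrossing.exists_fourArm_bound`
(`QuadCrossingDiscreteGluingGarban.lean`); the route's crux `FourArmBeyondOne` is that conclusion
with the two existentials reordered, so this file is pure glue.  Because the hypothesis itself is
proved in the tree (`Garban2011_fourArm_multiscale_holds`, `FourArmGarbanHolds.lean`), the crux
`FourArmBeyondOne` (item stmt-CriticalPhenomena-8579) follows unconditionally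
(`fourArmBeyondOne_proof`).
-/

namespace Summit.CriticalPhenomena.CardyFormulaZ2.Theorems

open Literature.Probability.Percolation

/-- **Item stmt-CriticalPhenomena-9115** (`FourArmOfGarban`): Garban's multi-scale four-arm bound
`Garban2011_fourArm_multiscale` implies the route's crux `FourArmBeyondOne`
(`∃ ε > 0, ∃ c > 0, π₄(m,n) ≤ c (m/n)^{1+ε}` for all `1 ≤ m ≤ n`, four arms in the cluster form
`fourArmTwoClusters`).  The RSW two-arm hypothesis of Garban's lemma is discharged in the tree by
`QuadCrossing.exists_fourArm_bound`; here only the order of the existentials changes. -/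
theorem fourArmOfGarban_proof :
    Summit.CriticalPhenomena.CardyFormulaZ2.Theses.CardyGluingRDE.FourArmOfGarban := by
  unfold Summit.CriticalPhenomena.CardyFormulaZ2.Theses.CardyGluingRDE.FourArmOfGarban
    Summit.CriticalPhenomena.CardyFormulaZ2.Theses.CardyGluingRDE.FourArmBeyondOne
  intro hG
  obtain ⟨c, ε, hc, hε, h⟩ := QuadCrossing.exists_fourArm_bound hG
  exact ⟨ε, hε, c, hc, h⟩

/-- **The crux `FourArmBeyondOne` unconditionally** (item stmt-CriticalPhenomena-8579 of the same
route): Garban's lemma is proved in the tree (`Garban2011_fourArm_multiscale_holds`), so the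
implication `fourArmOfGarban_proof` can be applied at once. -/
theorem fourArmBeyondOne_proof :
    Summit.CriticalPhenomena.CardyFormulaZ2.Theses.CardyGluingRDE.FourArmBeyondOne :=
  fourArmOfGarban_proof Garban2011_fourArm_multiscale_holds

end Summit.CriticalPhenomena.CardyFormulaZ2.Theorems
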